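import Summits.RiemannHypothesis.RiemannHypothesis.Theses.GroundBarta
import Summits.RiemannHypothesis.RiemannHypothesis.Theses.WeilParity
import Summits.RiemannHypothesis.RiemannHypothesis.Theorems.EvenWinsBeyondArch.Negative.KillCriterion
import Summits.RiemannHypothesis.RiemannHypothesis.Theorems.EvenWinsBeyondArch.Negative.LoadBearing
import Summits.RiemannHypothesis.RiemannHypothesis.Theorems.WeilParityEvenSectorWinsUpToLogThreeHalf
import Summits.RiemannHypothesis.RiemannHypothesis.Theorems.OddSectorOddNegativityOffLine
import Summits.RiemannHypothesis.RiemannHypothesis.Theorems.WeilParityOnePrimeWindowSimpleEven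

/-!
# Crux attack — `GroundBarta.EvenWinsBeyondArch` (stmt-RiemannHypothesis-18807), refuter-first, cycle 1

Kernel-checked readback and logic probes (refuter-rattack-stmt-RiemannHypothesis-18807-0, 2026-08-17).
Route GroundBarta rev 1 RESTATED WeilParity's crux stmt-15432 cone-free (inline `let C/M/Q` dictionary);
this file certifies, sorry-free:

* `gb_iff_weilParity` — the restatement is DEFINITIONALLY WeilParity's `EvenWinsBeyondArch` (`Iff.rfl`); hence every
  landed fact about stmt-15432 (Split, Negative/LoadBearing, Negative/KillCriterion, TwoScale) transports verbatim;
* `gb_iff_forall_le`, `not_gb_iff` — order form `∀ a > (log 2)/2, ε_ev(a) ≤ ε_od(a)` and negation normal form;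
* `gb_hyps_inhabited` — A3 non-vacuity: the hypotheses (window `a = 1 > (log 2)/2`, smooth odd normalised test) are
  satisfiable, RH-free;
* `gb_window_of_le_logThreeHalf` — the window clause HOLDS unconditionally on `(log 2)/2 < a ≤ (log 3)/2`
  (landed `evenSectorWins_upTo_logThreeHalf`): no counterexample below `(log 3)/2`;
* `gb_false_without_oddNorm` — the odd normalisation is load-bearing for the restated text too (transport);
* `gb_false_of_detection_of_not_RH` — RH-strength, formally (transport of the KillCriterion lemma);
* `rh_of_gb_of_detection`, `gb_of_rhImpliesEvenWins` — the restates-summit probes resolve only THROUGH the open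
  WeilParity items `OffLineParityDetection` (C → S) and `RHImpliesEvenWins` (S → C); bare `exact?` fails both ways
  (Scratch.lean);
* `gb_of_noParityCrossing` — with `OnePrimeWindowSimpleEven` PROVED, the crux is implied by the single open residue
  `NoParityCrossing` (stmt-18085);
* ROUTE-SPECIFIC MUTATION `rh_of_floor_pf_eventually` — GroundBarta's `closes` consumes the crux only on a TAIL of
  windows: `GroundBartaFloor → PolarPerronFrobenius → (∃ A', ∀ a ≥ A', EW a) → OddNegativityOffLine → RH`.
  The threshold `(log 2)/2` is not load-bearing in THIS route; `EventuallyEvenWins` (strictly weaker in form) would do.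

Axioms: propext, Classical.choice, Quot.sound.
-/

noncomputable section

namespace Summit.RiemannHypothesis.RiemannHypothesis.Cruxes.EvenWinsBeyondArch.GroundBartaAttack

set_option linter.dupNamespace false

open Set MeasureTheory Filter
open scoped Topology
open Literature.NumberTheory.LFunctions
open Summit.RiemannHypothesis.RiemannHypothesis.Theses
open Summit.RiemannHypothesis.RiemannHypothesis.Theorems
open Summit.RiemannHypothesis.RiemannHypothesis.Theorems.EvenWinsBeyondArch
open Summit.RiemannHypothesis.RiemannHypothesis.Theorems.EvenWinsBeyondArch.Negative

/-- The window-`a` clause `EW a` shared by both route files (Literature vocabulary). -/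
def EW (a : ℝ) : Prop :=
  ∀ o : ℝ → ℂ, IsWeilTest o → tsupport o ⊆ Icc (-a) a → (∀ t, o (-t) = -o t) →
    ∫ t, ‖o t‖ ^ 2 = (1 : ℝ) → ∀ δ : ℝ, 0 < δ → ∃ e : ℝ → ℂ, IsWeilTest e ∧ tsupport e ⊆ Icc (-a) a ∧
      (∀ t, e (-t) = e t) ∧ ∫ t, ‖e t‖ ^ 2 = (1 : ℝ) ∧ (weilQuadratic e).re ≤ (weilQuadratic o).re + δ

/-! ## A1/A2 — readback: the cone-free restatement is definitionally the WeilParity crux -/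

/-- DEFEQ CERTIFICATE: `GroundBarta.EvenWinsBeyondArch` (inline `C/M/Q`) is `Iff.rfl`-equal to
`WeilParity.EvenWinsBeyondArch` (Literature `IsWeilTest` / `weilQuadratic`). [folklore] -/
theorem gb_iff_weilParity : GroundBarta.EvenWinsBeyondArch ↔ WeilParity.EvenWinsBeyondArch := Iff.rfl

/-- Readback in words: `∀ a > (log 2)/2, EW a`. [folklore] -/
theorem gb_iff_forall_EW : GroundBarta.EvenWinsBeyondArch ↔ ∀ a : ℝ, Real.log 2 / 2 < a → EW a := Iff.rfl

/-- Order form: the crux says `ε_ev(a) ≤ ε_od(a)` for every `a > (log 2)/2`. [folklore] -/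
theorem gb_iff_forall_le :
    GroundBarta.EvenWinsBeyondArch ↔
      ∀ a : ℝ, Real.log 2 / 2 < a → weilEvenGroundEnergy a ≤ weilOddGroundEnergy a :=
  evenWinsBeyondArch_iff_forall_le

/-- Negation normal form (what a refutation must exhibit): a window beyond `(log 2)/2` where the odd
bottom is STRICTLY below the even bottom. [folklore] -/
theorem not_gb_iff :
    ¬ GroundBarta.EvenWinsBeyondArch ↔
      ∃ a : ℝ, Real.log 2 / 2 < a ∧ weilOddGroundEnergy a < weilEvenGroundEnergy a :=
  not_evenWinsBeyondArch_iff

/-! ## A3 — non-vacuity: the hypotheses are satisfiable -/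

/-- The hypothesis block of the crux is inhabited (window `a = 1`, a smooth odd `L²`-normalised test),
RH-free — the statement is not vacuously true. [folklore] -/
theorem gb_hyps_inhabited :
    ∃ a : ℝ, Real.log 2 / 2 < a ∧ ∃ o : ℝ → ℂ,
      (ContDiff ℝ ((⊤ : ℕ∞) : WithTop ℕ∞) o ∧ HasCompactSupport o) ∧ tsupport o ⊆ Icc (-a) a ∧
        (∀ t, o (-t) = -o t) ∧ ∫ t, ‖o t‖ ^ 2 = (1 : ℝ) := by
  obtain ⟨o, ho, hos, hodd, hon⟩ := exists_isWeilTest_odd_sphere (a := 1) one_pos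
  refine ⟨1, ?_, o, ho, hos, hodd, hon⟩
  have := Real.log_two_lt_d9
  linarith

/-! ## A4 — degenerate / boundary windows: no counterexample at or just above the threshold -/

/-- On the one-prime window `(log 2)/2 < a ≤ (log 3)/2` the window clause HOLDS unconditionally
(landed `WeilParity.evenSectorWins_upTo_logThreeHalf`: certified cells + archimedean rung). [folklore] -/
theorem gb_window_of_le_logThreeHalf {a : ℝ} (ha : Real.log 2 / 2 < a) (ha3 : a ≤ Real.log 3 / 2) :
    EW a :=
  fun o ho hos hodd hon δ hδ ↦
    WeilParity.evenSectorWins_upTo_logThreeHalf a (log_two_half_pos.trans ha) ha3 o ho hos hodd hon δ hδ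

/-- Hence any refuting window lies strictly beyond `(log 3)/2`. [folklore] -/
theorem logThreeHalf_lt_of_not_EW {a : ℝ} (ha : Real.log 2 / 2 < a) (h : ¬ EW a) :
    Real.log 3 / 2 < a := by
  by_contra hle
  exact h (gb_window_of_le_logThreeHalf ha (not_lt.1 hle))

/-! ## A5 — load-bearing hypotheses (transport of Negative/LoadBearing) -/

/-- The odd normalisation `∫ ‖o‖² = 1` is load-bearing for the restated text as well
(`o = 0` at `a = 2/5`, `ε_ev(2/5) > 0` RH-free). [folklore] -/
theorem gb_false_without_oddNorm :
    ¬ ∀ a : ℝ, Real.log 2 / 2 < a → ∀ o : ℝ → ℂ,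
        (ContDiff ℝ ((⊤ : ℕ∞) : WithTop ℕ∞) o ∧ HasCompactSupport o) → tsupport o ⊆ Icc (-a) a →
        (∀ t, o (-t) = -o t) → ∀ δ : ℝ, 0 < δ → ∃ e : ℝ → ℂ,
          (ContDiff ℝ ((⊤ : ℕ∞) : WithTop ℕ∞) e ∧ HasCompactSupport e) ∧
          tsupport e ⊆ Icc (-a) a ∧ (∀ t, e (-t) = e t) ∧ ∫ t, ‖e t‖ ^ 2 = (1 : ℝ) ∧
            (weilQuadratic e).re ≤ (weilQuadratic o).re + δ :=
  evenWinsBeyondArch_false_without_oddNorm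

/-- Without the evenness of the matching test the restated text is trivial (`e := o`). [folklore] -/
theorem gb_trivial_without_evenness :
    ∀ a : ℝ, Real.log 2 / 2 < a → ∀ o : ℝ → ℂ,
      (ContDiff ℝ ((⊤ : ℕ∞) : WithTop ℕ∞) o ∧ HasCompactSupport o) → tsupport o ⊆ Icc (-a) a →
      (∀ t, o (-t) = -o t) → ∫ t, ‖o t‖ ^ 2 = (1 : ℝ) → ∀ δ : ℝ, 0 < δ → ∃ e : ℝ → ℂ,
        (ContDiff ℝ ((⊤ : ℕ∞) : WithTop ℕ∞) e ∧ HasCompactSupport e) ∧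
        tsupport e ⊆ Icc (-a) a ∧ ∫ t, ‖e t‖ ^ 2 = (1 : ℝ) ∧
          (weilQuadratic e).re ≤ (weilQuadratic o).re + δ :=
  evenWinsBeyondArch_trivial_without_evenness

/-! ## Restates-summit probes: C → S and S → C go only through OPEN WeilParity items -/

/-- RH-STRENGTH, formally: under `¬RH` the restated crux is false as soon as WeilParity's detection crux
`OffLineParityDetection` (stmt-15431, open) holds. [folklore] -/
theorem gb_false_of_detection_of_not_RH (hdet : WeilParity.OffLineParityDetection)
    (hRH : ¬ _root_.Summit.RiemannHypothesis) : ¬ GroundBarta.EvenWinsBeyondArch :=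
  evenWinsBeyondArch_false_of_detection_of_not_RH hdet hRH

/-- C → S channel: the crux gives RH only together with `OffLineParityDetection` (route WeilParity's
deciding theorem with `EvenWinsArch` proved). [folklore] -/
theorem rh_of_gb_of_detection (h : GroundBarta.EvenWinsBeyondArch)
    (hdet : WeilParity.OffLineParityDetection) : _root_.Summit.RiemannHypothesis :=
  WeilParity.closes WeilParity.evenWinsArch_proof h hdet

/-- S → C channel: RH gives the crux only through the open calibration item `RHImpliesEvenWins`
(stmt-15436). [folklore] -/
theorem gb_of_rhImpliesEvenWins (hcal : WeilParity.RHImpliesEvenWins) (hRH : _root_.Summit.RiemannHypothesis) :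
    GroundBarta.EvenWinsBeyondArch :=
  fun a ha o ho hos hodd hon δ hδ ↦ hcal hRH a (log_two_half_pos.trans ha) o ho hos hodd hon δ hδ

/-- With `OnePrimeWindowSimpleEven` PROVED (`onePrimeWindowSimpleEven_proof`), the restated crux follows
from the single open residue `NoParityCrossing` (stmt-18085) — the intended one-line closure. [folklore] -/
theorem gb_of_noParityCrossing (h₂ : WeilParity.NoParityCrossing) : GroundBarta.EvenWinsBeyondArch :=
  evenWinsBeyondArch_of_subs WeilParity.onePrimeWindowSimpleEven_proof h₂

/-- Conversely a counterexample to the crux refutes `NoParityCrossing` (an exact tie beyond `(log 3)/2` is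
forced: anchor at `(log 3)/2`, RH-free sector continuity, IVT). [folklore] -/
theorem not_noParityCrossing_of_not_gb (h : ¬ GroundBarta.EvenWinsBeyondArch) :
    ¬ WeilParity.NoParityCrossing :=
  fun h₂ ↦ h (gb_of_noParityCrossing h₂)

/-! ## Route-specific mutation: GroundBarta consumes the crux only on a tail of windows -/

/-- `EventuallyEvenWins`: the window clause on SOME tail `[A', ∞)`. -/
def EventuallyEvenWins : Prop := ∃ A' : ℝ, ∀ a : ℝ, A' ≤ a → EW a

/-- The crux implies the tail form (trivially). [folklore] -/
theorem eventuallyEvenWins_of_gb (h : GroundBarta.EvenWinsBeyondArch) : EventuallyEvenWins := by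
  refine ⟨1, fun a ha ↦ h a ?_⟩
  have := Real.log_two_lt_d9
  linarith

/-- **The threshold `(log 2)/2` is NOT load-bearing in route GroundBarta**: its deciding theorem goes
through with the crux weakened to the tail form `EventuallyEvenWins` (same proof as `GroundBarta.closes`,
with the height raised to `max … A'`). Information for the planner: the cone-free restatement already
broke ledger-sharing with stmt-15432, so the route could equally want this weaker item. [folklore] -/
theorem rh_of_floor_pf_eventually (hFloor : GroundBarta.GroundBartaFloor)
    (hPF : GroundBarta.PolarPerronFrobenius) (hEven : EventuallyEvenWins)
    (hNeg : GroundBarta.OddNegativityOffLine) : _root_.Summit.RiemannHypothesis := by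
  show _root_.RiemannHypothesis
  by_contra hRH
  obtain ⟨η, hη, A, hAneg⟩ := hNeg hRH
  obtain ⟨e, he, a₀, hfloor⟩ := hFloor
  have hev : ∀ᶠ a in Filter.atTop, e a < η := he.eventually (Iio_mem_nhds hη)
  obtain ⟨A₁, hA₁⟩ := Filter.eventually_atTop.1 hev
  obtain ⟨A', hA'⟩ := hEven
  obtain ⟨a, ha, hgood⟩ := hPF (max (max (max A a₀) A₁) A')
  have haA : A ≤ a :=
    le_trans (le_trans (le_trans (le_max_left _ _) (le_max_left _ _)) (le_max_left _ _)) ha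
  have ha₀ : a₀ ≤ a :=
    le_trans (le_trans (le_trans (le_max_right _ _) (le_max_left _ _)) (le_max_left _ _)) ha
  have haA₁ : A₁ ≤ a := le_trans (le_trans (le_max_right _ _) (le_max_left _ _)) ha
  have haA' : A' ≤ a := le_trans (le_max_right _ _) ha
  have hwin := hgood (hA' a haA')
  obtain ⟨h, hh, hsupp, _, hnorm, hneg⟩ := hAneg a haA
  have h1 := hfloor a ha₀ hwin h hh hsupp hnorm
  have h2 : e a < η := hA₁ a haA₁
  have h3 : -e a ≤ -η := le_trans h1 hneg
  linarith

/-- The support item is the PROVED OddSector theorem (defeq), so in route GroundBarta the live content is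
`GroundBartaFloor ∧ PolarPerronFrobenius ∧ EventuallyEvenWins → RH`. [folklore] -/
theorem rh_of_floor_pf_eventually' (hFloor : GroundBarta.GroundBartaFloor)
    (hPF : GroundBarta.PolarPerronFrobenius) (hEven : EventuallyEvenWins) : _root_.Summit.RiemannHypothesis :=
  rh_of_floor_pf_eventually hFloor hPF hEven oddNegativityOffLine_proof

end Summit.RiemannHypothesis.RiemannHypothesis.Cruxes.EvenWinsBeyondArch.GroundBartaAttack

end
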